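import Summits.QuantumFields.GaugeBoot.FreeEnergyPlaquetteBounds
import Literature.MathematicalPhysics.QuantumFieldTheory.Balaban1983to89.InfiniteVolumeSufficientIII
import HarnessLib

/-!
# Gauge-boot: off a countable set of couplings, ALL infinite-volume limit points have the same plaquette —
# every compact gauge group, every dimension (supplement 21, part 1c)

HONEST FRAMING (cell `pub-gaugeboot`, page 1 of every file): certified bounds on lattice
expectations at STATED coupling, gauge group, dimension and torus size; NOT a mass gap, NOT a
continuum limit, NOT a string tension, NOT large `N`; NOT Yang–Mills-summit-bearing (barriers
`FixedCouplingUltralocality`, `PerturbativeInvisibility`).  A structural statement about the thermodynamic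
limit of the certified object; it says nothing about WHICH couplings are exceptional and certifies no number.

## Content

Part 1 (`eq_neg_deriv_of_mem_limitPoints`): where the torus free energy density `f` is differentiable, all
infinite-volume limit points give every plaquette the expectation `−f'(β)/#{i<j}` (as `N − ∫Re tr ρ(U_P) dμ`).  The tree
(`Balaban1983to89.Missing`, Friedli–Velenik Thm. B.12): `f` is convex (`convexOn_freeEnergyDensity`), and a convex function on
`ℝ` is differentiable off a countable set (`countable_not_differentiableAt_of_convexOn_univ`).  Hence:

* ★★★ `countable_exceptional_plaquette` — for every compact second-countable `G`, continuous `ρ` (`N ≥ 1`) and `d`, the set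
  of couplings `β` at which two infinite-volume limit points of the torus Wilson states disagree on some plaquette is
  COUNTABLE; more precisely ★★★ `integral_plaquetteObs_eq_of_not_mem` — off the countable set
  `{β : f not differentiable at β}`, **every limit point `μ` and every plaquette `(x; i ≠ j)` of `ℤ^d` satisfy
  `#{i<j}·(N − ∫Re tr ρ(U_{x;ij}) dμ) = −f'(β)`**, and ★★ `integral_plaquetteObs_eq_of_not_mem'` — any two limit points at such
  `β` give every plaquette the same expectation (the thermodynamic limit of `⟨ū_P⟩_{β,L}` along the full sequence then
  exists: `tendsto_wilsonActionDensity_of_differentiableAt` of the tree, restated per plaquette as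
  ★★ `tendsto_plaquetteExpectation_of_differentiableAt`).

[cite: FriedliVelenikSMLS2017, Thm. B.12(6)–(7) p.520; Cor. 3.7 p.99]  (Griffiths 1964.)
-/

noncomputable section

open MeasureTheory Filter Topology
open Literature.MathematicalPhysics.QuantumFieldTheory
open Literature.MathematicalPhysics.QuantumLattice (LGConfig plaquetteObs infiniteVolumeLimitPoints freeEnergyDensity torusLogPartition)
open Literature.MathematicalPhysics.QuantumFieldTheory.Balaban1983to89

namespace Summit.QuantumFields.GaugeBoot

namespace PlaquetteLimit

variable {d N : ℕ} {G : Type*} [Group G] [TopologicalSpace G] [IsTopologicalGroup G] [CompactSpace G]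
  [MeasurableSpace G] [BorelSpace G] [SecondCountableTopology G] (ρ : G →* Matrix (Fin N) (Fin N) ℂ)

/-- The exceptional set: couplings where the free energy density is not differentiable.  It is countable. [folklore] -/
theorem countable_not_differentiableAt (hρ : Continuous ρ) :
    {β : ℝ | ¬ DifferentiableAt ℝ (freeEnergyDensity d ρ) β}.Countable :=
  Missing.countable_not_differentiableAt_of_convexOn_univ (convexOn_freeEnergyDensity (d := d) ρ hρ)

/-- ★★★ **Off the countable exceptional set, every limit point has the plaquette `−f'(β)/#{i<j}`** (as the cost
`N − ∫Re tr ρ(U_P) dμ`). [folklore] -/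
theorem integral_plaquetteObs_eq_of_not_mem (hρ : Continuous ρ) (hN : N ≠ 0) {β : ℝ}
    (hβ : β ∉ {β : ℝ | ¬ DifferentiableAt ℝ (freeEnergyDensity d ρ) β})
    {μ : Measure (LGConfig d G)} (hμ : μ ∈ infiniteVolumeLimitPoints (d := d) ρ β)
    (x : Literature.Probability.LatticeModels.Site d) {i j : Fin d} (hij : i ≠ j) :
    (Fintype.card {p : Fin d × Fin d // p.1 < p.2} : ℝ) * ((N : ℝ) - ∫ U, plaquetteObs ρ x i j U ∂μ) =
      -deriv (freeEnergyDensity d ρ) β := by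
  have hdiff : DifferentiableAt ℝ (freeEnergyDensity d ρ) β := by
    by_contra h; exact hβ h
  exact eq_neg_deriv_of_mem_limitPoints (d := d) ρ hρ hN hdiff.hasDerivAt hμ x hij

/-- ★★ **Any two limit points agree on every plaquette off the exceptional set.** [folklore] -/
theorem integral_plaquetteObs_eq_of_not_mem' (hρ : Continuous ρ) (hN : N ≠ 0) (hd : 2 ≤ d) {β : ℝ}
    (hβ : β ∉ {β : ℝ | ¬ DifferentiableAt ℝ (freeEnergyDensity d ρ) β})
    {μ ν : Measure (LGConfig d G)} (hμ : μ ∈ infiniteVolumeLimitPoints (d := d) ρ β)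
    (hν : ν ∈ infiniteVolumeLimitPoints (d := d) ρ β)
    (x y : Literature.Probability.LatticeModels.Site d) {i j i' j' : Fin d} (hij : i ≠ j) (hij' : i' ≠ j') :
    ∫ U, plaquetteObs ρ x i j U ∂μ = ∫ U, plaquetteObs ρ y i' j' U ∂ν := by
  have h1 := integral_plaquetteObs_eq_of_not_mem (d := d) ρ hρ hN hβ hμ x hij
  have h2 := integral_plaquetteObs_eq_of_not_mem (d := d) ρ hρ hN hβ hν y hij'
  have hP : (0 : ℝ) < Fintype.card {p : Fin d × Fin d // p.1 < p.2} := by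
    have : Nonempty {p : Fin d × Fin d // p.1 < p.2} := ⟨⟨(⟨0, by omega⟩, ⟨1, by omega⟩), by simp [Fin.lt_def]⟩⟩
    exact_mod_cast Fintype.card_pos
  have := h1.trans h2.symm
  have := mul_left_cancel₀ hP.ne' this
  linarith

/-- ★★★ **The exceptional couplings are countable**: for every compact `G`, continuous `ρ` (`N ≥ 1`) and `d ≥ 2`, the set
of `β` at which two infinite-volume limit points of the torus Wilson states give some plaquettes different expectations is
countable. [folklore] -/
theorem countable_exceptional_plaquette (hρ : Continuous ρ) (hN : N ≠ 0) (hd : 2 ≤ d) :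
    {β : ℝ | ∃ μ ∈ infiniteVolumeLimitPoints (d := d) ρ β, ∃ ν ∈ infiniteVolumeLimitPoints (d := d) ρ β,
      ∃ (x y : Literature.Probability.LatticeModels.Site d) (i j i' j' : Fin d), i ≠ j ∧ i' ≠ j' ∧
        ∫ U, plaquetteObs ρ x i j U ∂μ ≠ ∫ U, plaquetteObs ρ y i' j' U ∂ν}.Countable := by
  refine (countable_not_differentiableAt (d := d) ρ hρ).mono fun β hβ => ?_
  obtain ⟨μ, hμ, ν, hν, x, y, i, j, i', j', hij, hij', hne⟩ := hβ
  by_contra hdiff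
  exact hne (integral_plaquetteObs_eq_of_not_mem' (d := d) ρ hρ hN hd hdiff hμ hν x y hij hij')

/-- ★★ **Off the exceptional set the mean plaquette converges along the FULL sequence of tori**: if `f` is
differentiable at `β` then `⟨ū_P⟩_{β,L+1} → 1 + f'(β)/(N·#{i<j})` as `L → ∞` (the tree's Griffiths lemma for the action
density, per plaquette). [folklore] -/
theorem tendsto_plaquetteExpectation_of_differentiableAt (hρ : Continuous ρ) (hN : N ≠ 0) (hd : 2 ≤ d) {β : ℝ}
    (hβ : DifferentiableAt ℝ (freeEnergyDensity d ρ) β) :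
    Tendsto (fun L : ℕ => wilsonExpectation ρ β (meanPlaquette (d := d) (L := L + 1) (G := G) ρ)) atTop
      (𝓝 (1 + deriv (freeEnergyDensity d ρ) β / (N * Fintype.card {p : Fin d × Fin d // p.1 < p.2}))) := by
  have ht := tendsto_wilsonActionDensity_of_differentiableAt (d := d) ρ hρ hβ
  have hNpos : (0 : ℝ) < N := by exact_mod_cast Nat.pos_of_ne_zero hN
  have hP : (0 : ℝ) < Fintype.card {p : Fin d × Fin d // p.1 < p.2} := by
    have : Nonempty {p : Fin d × Fin d // p.1 < p.2} := ⟨⟨(⟨0, by omega⟩, ⟨1, by omega⟩), by simp [Fin.lt_def]⟩⟩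
    exact_mod_cast Fintype.card_pos
  obtain ⟨i, j, hij⟩ : ∃ i j : Fin d, i ≠ j := ⟨⟨0, by omega⟩, ⟨1, by omega⟩, by simp [Fin.ext_iff]⟩
  -- `⟨ū⟩ = 1 − actionDensity/(N #{i<j})`
  have hform : ∀ L : ℕ, wilsonExpectation ρ β (meanPlaquette (d := d) (L := L + 1) (G := G) ρ) =
      1 - actionDensity ρ d β (L + 1) / (N * Fintype.card {p : Fin d × Fin d // p.1 < p.2}) := by
    intro L
    haveI : NeZero (L + 1) := ⟨Nat.succ_ne_zero L⟩
    obtain ⟨x⟩ : Nonempty (Site d (L + 1)) := ⟨fun _ => 0⟩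
    rw [actionDensity_eq_card_mul (d := d) (L := L + 1) ρ hρ hN β x hij,
      ← wilsonExpectation_meanPlaquette_eq_plaquetteTrace ρ hρ β x hij]
    field_simp
    ring
  have hdens : ∀ L : ℕ, actionDensity ρ d β (L + 1) =
      (((L + 1 : ℕ) : ℝ) ^ d)⁻¹ * wilsonExpectation ρ β (wilsonAction (d := d) (L := L + 1) (G := G) ρ) := fun L => rfl
  simp_rw [hform]
  have h2 : Tendsto (fun L : ℕ => 1 - actionDensity ρ d β (L + 1) / (N * Fintype.card {p : Fin d × Fin d // p.1 < p.2}))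
      atTop (𝓝 (1 - (-deriv (freeEnergyDensity d ρ) β) / (N * Fintype.card {p : Fin d × Fin d // p.1 < p.2}))) := by
    refine tendsto_const_nhds.sub (Tendsto.div_const ?_ _)
    simp_rw [hdens]
    exact ht
  rw [show 1 + deriv (freeEnergyDensity d ρ) β / (N * Fintype.card {p : Fin d × Fin d // p.1 < p.2}) =
    1 - (-deriv (freeEnergyDensity d ρ) β) / (N * Fintype.card {p : Fin d × Fin d // p.1 < p.2}) by ring]
  exact h2

end PlaquetteLimit

end Summit.QuantumFields.GaugeBoot

end
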